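import Summits.NavierStokesRegularity.NavierStokesRegularity.Theses.RellichScar
import Summits.NavierStokesRegularity.NavierStokesRegularity.Theorems.ScarRigidity.Negative.LogicAndLoadBearing
import Literature.Analysis.FluidPDE.TypeIAncientMild
import Literature.Analysis.FluidPDE.ParasiticSlabFlow
import Literature.Analysis.FluidPDE.JiaSverak2014SlabAprioriEstimate
import Literature.Analysis.FluidPDE.NSBoundedHigherRegularityQuantProofs
import Literature.Analysis.FluidPDE.NSBootstrapContinuousRep
import Literature.Analysis.FluidPDE.WeakSolutionProofs
import Summits.NavierStokesRegularity.NavierStokesRegularity.Theorems.SqueezeCycleExtremalElementExistsRescale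
import Summits.NavierStokesRegularity.NavierStokesRegularity.Theorems.RellichScarScarRigidityApexBoundsLeray
import HarnessLib

/-!
# `ScarRigidity` — line `finite-energy-log-convexity`, stub `stub_apexDerivativeBounds`:
# spatial derivative bounds off the axis of an apex profile (crux stmt-NavierStokesRegularity-11717)

Helper file for S1β. For Type-I ancient mild apex profiles (`IsTypeIAncientMild C V`,
`HasTypeIDecay C V`) we prove the **window construction** `exists_window_regularity`: near every
point `(s, x')`, `s < 0`, where `‖V‖ ≤ 2 max(C,0)`, all spatial derivatives of orders `≤ 3` are
bounded by `K₀(C)` on a parabolic cylinder of fixed size through `(s, x')` — local Leray theory on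
the window `[s - T_w/2, T_e)` (`isLocalLeraySolutionOn_shift`), Jia–Šverák's a priori estimate
(`apriori_unit_scale_slab`), the gauged cylinder pressure bound, and the quantitative higher
regularity of bounded distributional solutions (`NSBoundedHigherRegularityBounds_holds`,
Seregin–Šverák 2009, §2). At unit points `‖e‖ = 1` the apex bound supplies `‖V‖ ≤ 2C`; the zoom
with `c = ‖x‖` gives `‖DⁿV(t)(x)‖ ≤ K₀/‖x‖^{n+1}` off the axis, and with the core bounds the apex
weights `L/(‖x‖ + √(-t))^{n+1}`, `n ≤ 3`.
-/

noncomputable section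

open Set Filter Function MeasureTheory Metric TopologicalSpace
open scoped Topology ENNReal NNReal InnerProductSpace RealInnerProductSpace
open Literature.Analysis.FluidPDE
open Summit.NavierStokesRegularity.NavierStokesRegularity.Theses.RellichScar
open Summit.NavierStokesRegularity.NavierStokesRegularity.Theorems.ScarRigidity.Negative

set_option linter.dupNamespace false

namespace Summit.NavierStokesRegularity.NavierStokesRegularity.Theorems.RellichScarScarRigidity

open Literature.Analysis

/-! ## The unit-scale far-field bound -/

/-- The apex bound near a unit vector: `‖V(t, y)‖ ≤ 2C` for `‖y - e‖ < 1/2`, `‖e‖ = 1`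
(`‖y‖ ≥ 1/2` there). [folklore] -/
theorem norm_le_two_mul_of_near_unit {C : ℝ} {V : ℝ → (EuclideanSpace ℝ (Fin 3)) → (EuclideanSpace ℝ (Fin 3))} (hd : HasTypeIDecay C V)
    (hC : 0 ≤ C) {t : ℝ} (ht : t < 0) {e y : (EuclideanSpace ℝ (Fin 3))} (he : ‖e‖ = 1) (hy : dist y e < 1 / 2) :
    ‖V t y‖ ≤ 2 * C := by
  rw [dist_eq_norm] at hy
  have hyn : 1 / 2 ≤ ‖y‖ := by
    have : ‖e‖ ≤ ‖y‖ + ‖y - e‖ := by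
      calc ‖e‖ = ‖y - (y - e)‖ := by rw [sub_sub_cancel]
        _ ≤ ‖y‖ + ‖y - e‖ := norm_sub_le _ _
    linarith
  have hy0 : y ≠ 0 := by intro h; rw [h, norm_zero] at hyn; linarith
  calc ‖V t y‖ ≤ C / ‖y‖ := norm_le_div_norm_of_hasTypeIDecay hd hC ht hy0
    _ ≤ C / (1 / 2) := div_le_div_of_nonneg_left hC (by norm_num) hyn
    _ = 2 * C := by ring

/-- **The window construction, uniformly over the class.** There are `T_w, R, K₀`, depending on
`C` only (`0 < T_w ≤ 1`, `0 < R ≤ 1/2`, `R² ≤ T_w/4`, `0 ≤ K₀`), such that for every apex profile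
`V` of constant `C`, every `s < 0` and every centre `x'` near which `‖V‖ ≤ 2 max(C, 0)` (on
`{τ < s/2} × B_{1/2}(x')`), with `t₀ = s - T_w/2` there are a margin `ε` (`0 < ε ≤ -s/4`,
`ε < (R/2)²`) and a classical pressure `p` of `V` on `(t₀ - 1, 0)` such that the shifted pair is
a local Leray solution on `(0, T_w/2 + 2ε) × ℝ³` and **all spatial derivatives of orders `≤ 3`
of `V(· + t₀)` are bounded by `K₀` on the parabolic cylinder `Q_{R/2}(T_w/2 + ε, x')`** (which
contains `(T_w/2, x')`, i.e. the point `(s, x')`). Mechanism: Jia–Šverák's a priori estimate on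
the window (`apriori_unit_scale_slab`), the gauged cylinder pressure bound
(`exists_window_pressure_bound_slab` with `IsLocalLeraySolutionOn.exists_measurable_gauge`),
and the quantitative higher regularity of bounded distributional solutions
(`NSBoundedHigherRegularityBounds_holds`, Seregin–Šverák 2009, §2 p. 8), identified with the
continuous `V`. [cite: SereginSverak2009, §2 p. 8 (∇ᵏv Hölder in Q̄₂, norms estimated by the data)] [cite: JiaSverak2014, §3 Lemma 3.1 (arXiv:1204.0529 p. 7)] -/
theorem exists_window_regularity (C : ℝ) :
    ∃ Tw R K₀ : ℝ, 0 < Tw ∧ Tw ≤ 1 ∧ 0 < R ∧ R ≤ 1 / 2 ∧ R ^ 2 ≤ Tw / 4 ∧ 0 ≤ K₀ ∧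
      ∀ ⦃V : ℝ → (EuclideanSpace ℝ (Fin 3)) → (EuclideanSpace ℝ (Fin 3))⦄, IsTypeIAncientMild C V → HasTypeIDecay C V →
        ∀ s < 0, ∀ x' : (EuclideanSpace ℝ (Fin 3)),
          (∀ τ < s / 2, ∀ y : (EuclideanSpace ℝ (Fin 3)), dist y x' < 1 / 2 → ‖V τ y‖ ≤ 2 * max C 0) →
          ∃ (ε : ℝ) (p : ℝ → (EuclideanSpace ℝ (Fin 3)) → ℝ), 0 < ε ∧ ε ≤ -s / 4 ∧ ε < (R / 2) ^ 2 ∧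
            IsClassicalNSSolutionOn (Ioo (s - Tw / 2 - 1) 0) 1 0 V p ∧
            IsLocalLeraySolutionOn (Tw / 2 + 2 * ε) 1 (V (s - Tw / 2))
              (fun τ => V (τ + (s - Tw / 2))) (fun τ => p (τ + (s - Tw / 2))) ∧
            ∀ w ∈ parabolicCylinder (R / 2) ((Tw / 2 + ε, x') : ℝ × (EuclideanSpace ℝ (Fin 3))), ∀ n ≤ 3,
              ‖iteratedFDeriv ℝ n (V (w.1 + (s - Tw / 2))) w.2‖ ≤ K₀ := by
  -- ## universal constants
  obtain ⟨α, hα⟩ := exists_datum_energy_bound C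
  obtain ⟨ε₀, hε₀, hε₀1, Cₐ, hAP⟩ := JiaSverak2014.apriori_unit_scale_slab
  obtain ⟨P₀, hP₀⟩ := JiaSverak2014.exists_window_pressure_bound_slab
  -- the window length
  set Tw : ℝ := min (ε₀ : ℝ) ((ε₀ : ℝ) / ((α : ℝ) ^ 2 + 1)) with hTw
  have hε₀r : (0 : ℝ) < ε₀ := by exact_mod_cast hε₀
  have hTw0 : 0 < Tw := lt_min hε₀r (by positivity)
  have hTwε : Tw ≤ (ε₀ : ℝ) := min_le_left _ _
  have hTw1 : Tw ≤ 1 := hTwε.trans (by exact_mod_cast hε₀1)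
  have hTwα : Tw * (α : ℝ) ^ 2 ≤ (ε₀ : ℝ) := by
    calc Tw * (α : ℝ) ^ 2 ≤ (ε₀ : ℝ) / ((α : ℝ) ^ 2 + 1) * ((α : ℝ) ^ 2 + 1) :=
        mul_le_mul (min_le_right _ _) (by linarith) (sq_nonneg _) (by positivity)
      _ = (ε₀ : ℝ) := div_mul_cancel₀ _ (by positivity)
  -- the radius: `R ≤ 1/2`, `R² ≤ Tw/4`
  set R : ℝ := min (1 / 2) (Real.sqrt Tw / 2) with hR
  have hR0 : 0 < R := lt_min (by norm_num) (by positivity)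
  have hR12 : R ≤ 1 / 2 := min_le_left _ _
  have hR2 : R ^ 2 ≤ Tw / 4 := by
    have h1 : R ≤ Real.sqrt Tw / 2 := min_le_right _ _
    have h2 : R ^ 2 ≤ (Real.sqrt Tw / 2) ^ 2 := pow_le_pow_left₀ hR0.le h1 2
    rw [div_pow, Real.sq_sqrt hTw0.le] at h2
    linarith
  -- energies and the pressure constant
  set M₁ : ℝ≥0 := 2 * Cₐ * α with hM₁
  set Ptop : ℝ≥0∞ := (P₀ : ℝ≥0∞) * (M₁ : ℝ≥0∞) ^ (3 / 2 : ℝ) with hPtop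
  have hPtop_ne : Ptop ≠ ⊤ :=
    ENNReal.mul_ne_top ENNReal.coe_ne_top (ENNReal.rpow_ne_top_of_nonneg (by norm_num) ENNReal.coe_ne_top)
  set P : ℝ≥0 := Ptop.toNNReal with hP
  have hPeq : (P : ℝ≥0∞) = Ptop := ENNReal.coe_toNNReal hPtop_ne
  -- the velocity bound near the centre
  set Mv : ℝ := 2 * max C 0 with hMv
  -- the higher-regularity constant
  have hrR : R / 2 ∈ Ioo 0 R := ⟨by positivity, by linarith⟩
  obtain ⟨K₀, hK₀⟩ := NSBoundedHigherRegularityBounds_holds.exists_uniform_bound R Mv P hrR 3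
  refine ⟨Tw, R, max K₀ 0, hTw0, hTw1, hR0, hR12, hR2, le_max_right _ _,
    fun V hV hd s hs x' hMvV => ?_⟩
  -- ## the window and the cylinder
  set ε : ℝ := min (-s / 4) (R ^ 2 / 8) with hε
  have hε0 : 0 < ε := lt_min (by linarith) (by positivity)
  have hεs : ε ≤ -s / 4 := min_le_left _ _
  have hεR : ε ≤ R ^ 2 / 8 := min_le_right _ _
  have hεR2 : ε < (R / 2) ^ 2 := by rw [div_pow]; nlinarith
  set t₀ : ℝ := s - Tw / 2 with ht₀
  set Tsl : ℝ := Tw / 2 + 2 * ε with hTsl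
  set Te : ℝ := t₀ + Tsl with hTe
  have hTsl0 : 0 < Tsl := by positivity
  have hTslw : Tsl ≤ Tw := by
    have : 2 * ε ≤ Tw / 2 := by nlinarith
    linarith
  have hTsl1 : Tsl - 0 ≤ 1 := by linarith
  have ht₀e : t₀ < Te := by rw [hTe]; linarith
  have hTes : Te ≤ s / 2 := by
    have : Te = s + 2 * ε := by rw [hTe, ht₀, hTsl]; ring
    rw [this]; linarith
  have hTe0 : Te < 0 := by linarith
  have hTeS : Te - t₀ = Tsl := by rw [hTe]; ring
  -- ## the local Leray solution on the window
  obtain ⟨p, hcl⟩ := hV.exists_isClassicalNSSolutionOn_Ioo (t₀ := t₀ - 1) (by linarith)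
  have hLL : IsLocalLeraySolutionOn Tsl 1 (V t₀) (fun τ => V (τ + t₀)) (fun τ => p (τ + t₀)) := by
    have h := isLocalLeraySolutionOn_shift hV hd ht₀e hTe0 hcl
    rwa [hTeS] at h
  have hG : HasWeakSpatialGradientOn (slab (EuclideanSpace ℝ (Fin 3)) (Ioo 0 Tsl) isOpen_Ioo) (fun τ => V (τ + t₀))
      fun τ x => fderiv ℝ (V (τ + t₀)) x := by
    have h := hasWeakSpatialGradientOn_shift (t₀ := t₀) hTe0 hcl
    rwa [hTeS] at h
  refine ⟨ε, p, hε0, hεs, hεR2, hcl, hLL, ?_⟩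
  set u : ℝ → (EuclideanSpace ℝ (Fin 3)) → (EuclideanSpace ℝ (Fin 3)) := fun τ => V (τ + t₀) with hu
  set q : ℝ → (EuclideanSpace ℝ (Fin 3)) → ℝ := fun τ => p (τ + t₀) with hq
  have huM : ∀ τ, τ < Tsl → ∀ y : (EuclideanSpace ℝ (Fin 3)), dist y x' < 1 / 2 → ‖u τ y‖ ≤ Mv := by
    intro τ hτ y hy
    have : τ + t₀ < s / 2 := by
      have h1 : τ + t₀ < Te := by rw [hTe]; linarith
      linarith
    exact hMvV (τ + t₀) this y hy
  -- ## the a priori estimate on `(0, Tsl)`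
  have hm₀ : AEStronglyMeasurable (V t₀) volume := hV.aestronglyMeasurable_slice (by linarith)
  have hdat : ∀ x₀ : (EuclideanSpace ℝ (Fin 3)), ∫⁻ x in ball x₀ 1, ‖V t₀ x‖ₑ ^ 2 ≤ 2 * (α : ℝ≥0∞) :=
    fun x₀ => hα hd t₀ (by linarith) x₀
  obtain ⟨hE, hD, -⟩ := hAP (V t₀) u q _ α Tsl Tsl hm₀ hLL hG hdat hTsl0 le_rfl
    (hTslw.trans hTwε) ((mul_le_mul_of_nonneg_right hTslw (sq_nonneg _)).trans hTwα)
  have hME : 2 * ((Cₐ * α : ℝ≥0) : ℝ≥0∞) = (M₁ : ℝ≥0∞) := by rw [hM₁]; push_cast; ring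
  have hMD : ((Cₐ * α : ℝ≥0) : ℝ≥0∞) ≤ (M₁ : ℝ≥0∞) := by
    rw [← hME]
    calc ((Cₐ * α : ℝ≥0) : ℝ≥0∞) = 1 * ((Cₐ * α : ℝ≥0) : ℝ≥0∞) := (one_mul _).symm
      _ ≤ 2 * ((Cₐ * α : ℝ≥0) : ℝ≥0∞) := by gcongr; norm_num
  have hE' : ∀ᵐ t ∂(volume.restrict (Ioo 0 Tsl)), ∀ z : (EuclideanSpace ℝ (Fin 3)), ∫⁻ y in ball z 1, ‖u t y‖ₑ ^ 2 ≤ (M₁ : ℝ≥0∞) := by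
    filter_upwards [hE] with t ht z
    rw [← hME]; exact ht z
  have hD' : ∀ z : (EuclideanSpace ℝ (Fin 3)), ∫⁻ w in Ioo 0 Tsl ×ˢ ball z 1,
      ENNReal.ofReal (frobeniusNormSq (fderiv ℝ (V (w.1 + t₀)) w.2)) ≤ (M₁ : ℝ≥0∞) :=
    fun z => (hD z).trans hMD
  -- ## the gauge of the local pressure expansion at the centre
  obtain ⟨c, hcm, hcL, hdec, hcfin⟩ := hLL.exists_measurable_gauge x'
  have hqc : IsLocalLeraySolutionOn Tsl 1 (V t₀) u (fun τ y => q τ y - c τ) :=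
    hLL.sub_pressure hcm hcL hcfin
  have hpress : ∫⁻ w in Ioo 0 Tsl ×ˢ ball x' 3, ‖q w.1 w.2 - c w.1‖ₑ ^ (3 / 2 : ℝ) ≤
      (P₀ : ℝ≥0∞) * (M₁ : ℝ≥0∞) ^ (3 / 2 : ℝ) * ENNReal.ofReal (Tsl - 0) ^ (1 / 4 : ℝ) :=
    hP₀ hLL.aestronglyMeasurable hLL.aestronglyMeasurable_pressure
      (fun y ρ' => hLL.lintegral_cube_box_lt_top y ρ') hG le_rfl hTsl0.le le_rfl hTsl1 x'
      hcm.aestronglyMeasurable hdec ENNReal.coe_ne_top le_rfl le_rfl hE' hD'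
  -- ## the cylinder `Q_R(z)`, `z = (Tw/2 + ε, x')`
  set z : ℝ × (EuclideanSpace ℝ (Fin 3)) := (Tw / 2 + ε, x') with hz
  have hz1 : z.1 = Tw / 2 + ε := rfl
  have hz2 : z.2 = x' := rfl
  have hcyl_slab : parabolicCylinderOpens R z ≤ slab (EuclideanSpace ℝ (Fin 3)) (Ioo 0 Tsl) isOpen_Ioo := by
    intro w hw
    change w ∈ parabolicCylinder R z at hw
    rw [mem_parabolicCylinder, hz1] at hw
    refine mem_slab.2 ⟨?_, ?_⟩
    · have : R ^ 2 ≤ Tw / 2 := by linarith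
      linarith [hw.1.1]
    · rw [hTsl]; linarith [hw.1.2]
  have hcyl_sub : parabolicCylinder R z ⊆ Ioo 0 Tsl ×ˢ ball x' 3 := by
    intro w hw
    have hw' := hw
    rw [mem_parabolicCylinder, hz1, hz2] at hw'
    refine ⟨mem_slab.1 (hcyl_slab hw), ?_⟩
    exact mem_ball.2 (hw'.2.trans_le (by linarith))
  have hdist : IsDistributionalNSSolutionOn (parabolicCylinderOpens R z) 1 0 u (fun τ y => q τ y - c τ) :=
    hqc.distributional.of_le hcyl_slab
  have hbdd : ∀ᵐ w ∂(volume.restrict (parabolicCylinder R z)), ‖u w.1 w.2‖ ≤ Mv := by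
    refine (ae_restrict_mem (isOpen_parabolicCylinder R z).measurableSet).mono fun w hw => ?_
    have hw' := hw
    rw [mem_parabolicCylinder, hz1, hz2] at hw'
    exact huM w.1 (mem_slab.1 (hcyl_slab hw)).2 w.2 (hw'.2.trans_le hR12)
  have hPcyl : ∫⁻ w in parabolicCylinder R z, ‖(q w.1 w.2 - c w.1 : ℝ)‖ₑ ^ (3 / 2 : ℝ) ≤ (P : ℝ≥0∞) := by
    refine (lintegral_mono_set hcyl_sub).trans (hpress.trans ?_)
    rw [hPeq, hPtop]
    calc (P₀ : ℝ≥0∞) * (M₁ : ℝ≥0∞) ^ (3 / 2 : ℝ) * ENNReal.ofReal (Tsl - 0) ^ (1 / 4 : ℝ)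
        ≤ (P₀ : ℝ≥0∞) * (M₁ : ℝ≥0∞) ^ (3 / 2 : ℝ) * 1 := by
          gcongr
          refine ENNReal.rpow_le_one ?_ (by norm_num)
          rw [sub_zero]
          exact ENNReal.ofReal_le_one.2 (hTslw.trans hTw1)
      _ = _ := mul_one _
  -- ## higher regularity on the cylinder and identification
  obtain ⟨W, hae, hWc, -, -, hWb⟩ := hK₀ u (fun τ y => q τ y - c τ) z hdist hbdd hPcyl
  have huc : ContinuousOn (uncurry u) (parabolicCylinder R z) := by
    have h1 : ContinuousOn (uncurry u) (Ioo (-1 : ℝ) (-t₀) ×ˢ univ) :=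
      (isClassicalNSSolutionOn_shift hcl).smooth_velocity.continuousOn
    refine h1.mono fun w hw => ?_
    have h2 := mem_slab.1 (hcyl_slab hw)
    refine ⟨⟨by linarith [h2.1], ?_⟩, mem_univ _⟩
    have : w.1 < Tsl := h2.2
    have : Tsl < -t₀ := by
      have := hTe0; rw [hTe] at this; linarith
    linarith
  have heq : EqOn (uncurry u) (uncurry W) (parabolicCylinder R z) :=
    NSBootstrap.eqOn_of_ae_eq_of_continuousOn (isOpen_parabolicCylinder R z) huc hWc hae
  -- derivative bounds for `u` itself on the half cylinder
  intro w hw n hn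
  have hw' := hw
  rw [mem_parabolicCylinder] at hw'
  have hev : u w.1 =ᶠ[𝓝 w.2] W w.1 := by
    have hball : ball x' R ∈ 𝓝 w.2 :=
      isOpen_ball.mem_nhds (mem_ball.2 (hw'.2.trans (half_lt_self hR0)))
    filter_upwards [hball] with y hy
    have hmem : ((w.1, y) : ℝ × (EuclideanSpace ℝ (Fin 3))) ∈ parabolicCylinder R z := by
      rw [mem_parabolicCylinder, hz1, hz2]
      refine ⟨⟨?_, hw'.1.2⟩, mem_ball.1 hy⟩
      have h4 : (R / 2) ^ 2 ≤ R ^ 2 := by rw [div_pow]; nlinarith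
      linarith [hw'.1.1]
    exact heq hmem
  have hder : iteratedFDeriv ℝ n (u w.1) w.2 = iteratedFDeriv ℝ n (W w.1) w.2 :=
    (hev.iteratedFDeriv ℝ n).eq_of_nhds
  show ‖iteratedFDeriv ℝ n (u w.1) w.2‖ ≤ max K₀ 0
  rw [hder]
  exact (hWb n hn w hw).trans (le_max_left _ _)

/-- **Unit-scale far-field bound, uniformly over the class.** There is `K₀ = K₀(C)` such that
`‖DⁿV(s)(e)‖ ≤ K₀` for all `n ≤ 3`, `s < 0`, `‖e‖ = 1` and all `V` with `IsTypeIAncientMild C V`,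
`HasTypeIDecay C V` (`exists_window_regularity` at the point `(T_w/2, e)` of the cylinder; the
apex bound gives `‖V‖ ≤ 2C` near the unit sphere at all times). [cite: SereginSverak2009, §2 p. 8] -/
theorem exists_unit_far_bound (C : ℝ) :
    ∃ K₀ : ℝ, ∀ ⦃V : ℝ → (EuclideanSpace ℝ (Fin 3)) → (EuclideanSpace ℝ (Fin 3))⦄, IsTypeIAncientMild C V → HasTypeIDecay C V →
      ∀ s < 0, ∀ e : (EuclideanSpace ℝ (Fin 3)), ‖e‖ = 1 → ∀ n ≤ 3, ‖iteratedFDeriv ℝ n (V s) e‖ ≤ K₀ := by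
  obtain ⟨Tw, R, K₀, hTw0, -, hR0, -, -, -, hreg⟩ := exists_window_regularity C
  refine ⟨K₀, fun V hV hd s hs e he n hn => ?_⟩
  have hC : 0 ≤ C := hV.nonneg
  have hMv : ∀ τ < s / 2, ∀ y : (EuclideanSpace ℝ (Fin 3)), dist y e < 1 / 2 → ‖V τ y‖ ≤ 2 * max C 0 := by
    intro τ hτ y hy
    rw [max_eq_left hC]
    exact norm_le_two_mul_of_near_unit hd hC (by linarith) he hy
  obtain ⟨ε, p, hε0, -, hεR2, -, -, hK⟩ := hreg hV hd s hs e hMv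
  have hw₀ : ((Tw / 2, e) : ℝ × (EuclideanSpace ℝ (Fin 3))) ∈ parabolicCylinder (R / 2) ((Tw / 2 + ε, e) : ℝ × (EuclideanSpace ℝ (Fin 3))) := by
    rw [mem_parabolicCylinder]
    exact ⟨⟨by simp only; linarith, by simp only; linarith⟩, by rw [dist_self]; positivity⟩
  have h := hK _ hw₀ n hn
  have e1 : Tw / 2 + (s - Tw / 2) = s := by ring
  simp only [e1] at h
  exact h

/-! ## Scaling to all points off the axis -/

section Zoom

variable {C : ℝ} {V : ℝ → (EuclideanSpace ℝ (Fin 3)) → (EuclideanSpace ℝ (Fin 3))}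

/-- **The apex bound is invariant under the Navier–Stokes zoom** about the space–time origin:
`‖c V(c²s, c y)‖ ≤ c · C/(‖c y‖ + √(-c² s)) = C/(‖y‖ + √(-s))` for `c > 0`. [folklore] -/
theorem hasTypeIDecay_zoom (hd : HasTypeIDecay C V) {c : ℝ} (hc : 0 < c) :
    HasTypeIDecay C (c • stPull (c ^ 2) c 0 0 V) := by
  intro s hs y
  have hs' : c ^ 2 * s < 0 := mul_neg_of_pos_of_neg (pow_pos hc 2) hs
  rw [zoom_apply, norm_smul, Real.norm_of_nonneg hc.le, zero_add]
  have h := hd (c ^ 2 * s) hs' (c • y)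
  have hsq : Real.sqrt (-(c ^ 2 * s)) = c * Real.sqrt (-s) := by
    rw [show -(c ^ 2 * s) = c ^ 2 * (-s) by ring, Real.sqrt_mul' _ (neg_nonneg.2 hs.le),
      Real.sqrt_sq hc.le]
  rw [hsq, norm_smul, Real.norm_of_nonneg hc.le, ← mul_add] at h
  have hden : 0 < ‖y‖ + Real.sqrt (-s) :=
    add_pos_of_nonneg_of_pos (norm_nonneg _) (Real.sqrt_pos.2 (neg_pos.2 hs))
  calc c * ‖V (c ^ 2 * s) (c • y)‖ ≤ c * (C / (c * (‖y‖ + Real.sqrt (-s)))) :=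
        mul_le_mul_of_nonneg_left h hc.le
    _ = C / (‖y‖ + Real.sqrt (-s)) := by field_simp

/-- The zoom with a general scale `c > 0` recovers every slice:
`V t y = c⁻¹ W(c⁻² t)(c⁻¹ y)` for `W(σ, η) = c V(c² σ, c η)`. [folklore] -/
theorem slice_eq_zoom_fun {c : ℝ} (hc : 0 < c) (t : ℝ) :
    V t = fun y => c⁻¹ • (c • stPull (c ^ 2) c 0 0 V) ((c ^ 2)⁻¹ * t) (c⁻¹ • y) := by
  funext y
  have hc2 : c ^ 2 ≠ 0 := pow_ne_zero 2 hc.ne'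
  rw [zoom_apply, smul_smul, inv_mul_cancel₀ hc.ne', one_smul, zero_add, smul_smul,
    mul_inv_cancel₀ hc.ne', one_smul, ← mul_assoc, mul_inv_cancel₀ hc2, one_mul]

/-- **Scaling of spatial derivatives with a general scale**:
`‖DⁿV(t)(y)‖ ≤ c^{-(n+1)} ‖DⁿW(c⁻²t)(c⁻¹y)‖`. [folklore] -/
theorem norm_iteratedFDeriv_slice_le_zoom_gen {c : ℝ} (hc : 0 < c) (t : ℝ) (n : ℕ) (y : (EuclideanSpace ℝ (Fin 3))) :
    ‖iteratedFDeriv ℝ n (V t) y‖ ≤ (c⁻¹) ^ (n + 1) *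
      ‖iteratedFDeriv ℝ n ((c • stPull (c ^ 2) c 0 0 V) ((c ^ 2)⁻¹ * t)) (c⁻¹ • y)‖ := by
  have hci : 0 < c⁻¹ := inv_pos.2 hc
  set W := (c • stPull (c ^ 2) c 0 0 V) ((c ^ 2)⁻¹ * t) with hW
  rw [slice_eq_zoom_fun (V := V) hc t]
  have h1 : iteratedFDeriv ℝ n (fun y => c⁻¹ • W (c⁻¹ • y)) y =
      c⁻¹ • iteratedFDeriv ℝ n (fun y => W (c⁻¹ • y)) y := by
    rw [iteratedFDeriv_const_smul_real (fun y => W (c⁻¹ • y)) c⁻¹ n]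
  rw [← hW, h1, norm_smul, Real.norm_of_nonneg hci.le, pow_succ, mul_comm _ c⁻¹, mul_assoc]
  refine mul_le_mul_of_nonneg_left ?_ hci.le
  have h2 := norm_iteratedFDeriv_comp_smul_le W hci.ne' n y
  rwa [abs_of_pos hci] at h2

end Zoom

/-- **Spatial derivative bounds off the axis**: there is `K₀ = K₀(C) ≥ 0` with
`‖DⁿV(t)(x)‖ ≤ K₀ / ‖x‖^{n+1}` for `n ≤ 3`, all `t < 0`, `x ≠ 0` and all `V` in the class (the
unit-scale bound transported by the zoom with `c = ‖x‖`). [cite: SereginSverak2009, §2 p. 8] -/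
theorem exists_norm_iteratedFDeriv_le_far (C : ℝ) :
    ∃ K₀ : ℝ, 0 ≤ K₀ ∧ ∀ ⦃V : ℝ → (EuclideanSpace ℝ (Fin 3)) → (EuclideanSpace ℝ (Fin 3))⦄, IsTypeIAncientMild C V → HasTypeIDecay C V →
      ∀ t < 0, ∀ x : (EuclideanSpace ℝ (Fin 3)), x ≠ 0 → ∀ n ≤ 3, ‖iteratedFDeriv ℝ n (V t) x‖ ≤ K₀ / ‖x‖ ^ (n + 1) := by
  obtain ⟨K₀, hK₀⟩ := exists_unit_far_bound C
  refine ⟨max K₀ 0, le_max_right _ _, fun V hV hd t ht x hx n hn => ?_⟩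
  have hc : 0 < ‖x‖ := norm_pos_iff.2 hx
  have hW := isTypeIAncientMild_zoom hV hc (0 : (EuclideanSpace ℝ (Fin 3)))
  have hWd := hasTypeIDecay_zoom hd hc
  have hs : (‖x‖ ^ 2)⁻¹ * t < 0 := mul_neg_of_pos_of_neg (inv_pos.2 (pow_pos hc 2)) ht
  have he : ‖‖x‖⁻¹ • x‖ = 1 := by
    rw [norm_smul, norm_inv, norm_norm, inv_mul_cancel₀ hc.ne']
  refine (norm_iteratedFDeriv_slice_le_zoom_gen hc t n x).trans ?_
  rw [inv_pow, ← div_eq_inv_mul]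
  exact div_le_div_of_nonneg_right ((hK₀ hW hWd _ hs _ he n hn).trans (le_max_left _ _))
    (pow_nonneg hc.le _)

/-- **The apex-weighted gradient and Hessian bounds of S1β** (and the orders `n ≤ 3`): one
constant `L = L(C)` with `‖DⁿV(t)(x)‖ ≤ L/(‖x‖ + √(-t))^{n+1}` for `n ≤ 3`, all `t < 0`, all `x`,
and all `V` with `IsTypeIAncientMild C V`, `HasTypeIDecay C V`. [cite: KochNadirashviliSereginSverak2009, Prop. 4.1 (arXiv:0709.3599v1 p. 8)] [cite: SereginSverak2009, §2 p. 8] -/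
theorem exists_norm_iteratedFDeriv_le_apex (C : ℝ) :
    ∃ L : ℝ, 0 ≤ L ∧ ∀ ⦃V : ℝ → (EuclideanSpace ℝ (Fin 3)) → (EuclideanSpace ℝ (Fin 3))⦄, IsTypeIAncientMild C V → HasTypeIDecay C V →
      ∀ n ≤ 3, ∀ t < 0, ∀ x : (EuclideanSpace ℝ (Fin 3)),
        ‖iteratedFDeriv ℝ n (V t) x‖ ≤ L / (‖x‖ + Real.sqrt (-t)) ^ (n + 1) := by
  obtain ⟨K₀, hK₀0, hK₀⟩ := exists_norm_iteratedFDeriv_le_far C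
  obtain ⟨A₀, hA₀0, hA₀⟩ := exists_norm_iteratedFDeriv_le_core C 0
  obtain ⟨A₁, hA₁0, hA₁⟩ := exists_norm_iteratedFDeriv_le_core C 1
  obtain ⟨A₂, hA₂0, hA₂⟩ := exists_norm_iteratedFDeriv_le_core C 2
  obtain ⟨A₃, hA₃0, hA₃⟩ := exists_norm_iteratedFDeriv_le_core C 3
  set A : ℝ := A₀ + A₁ + A₂ + A₃ with hAdef
  have hA0 : 0 ≤ A := by positivity
  refine ⟨2 ^ 4 * (A + K₀), by positivity, fun V hV hd n hn t ht x => ?_⟩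
  have hcore : ‖iteratedFDeriv ℝ n (V t) x‖ ≤ A / Real.sqrt (-t) ^ (n + 1) := by
    have hc : 0 < Real.sqrt (-t) := Real.sqrt_pos.2 (neg_pos.2 ht)
    have hmono : ∀ {A' : ℝ}, A' ≤ A → ‖iteratedFDeriv ℝ n (V t) x‖ ≤ A' / Real.sqrt (-t) ^ (n + 1) →
        ‖iteratedFDeriv ℝ n (V t) x‖ ≤ A / Real.sqrt (-t) ^ (n + 1) := fun hA' h =>
      h.trans (div_le_div_of_nonneg_right hA' (pow_nonneg hc.le _))
    interval_cases n
    · exact hmono (by linarith) (hA₀ hV t ht x)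
    · exact hmono (by linarith) (hA₁ hV t ht x)
    · exact hmono (by linarith) (hA₂ hV t ht x)
    · exact hmono (by linarith) (hA₃ hV t ht x)
  have h := le_apex_weight_of_core_of_far hA0 hK₀0 ht (n + 1) hcore
    (fun hx => hK₀ hV hd t ht x hx n hn)
  refine h.trans (div_le_div_of_nonneg_right ?_ (pow_nonneg
    (add_pos_of_nonneg_of_pos (norm_nonneg _) (Real.sqrt_pos.2 (neg_pos.2 ht))).le _))
  have h2 : (2 : ℝ) ^ (n + 1) ≤ 2 ^ 4 := pow_le_pow_right₀ (by norm_num) (by omega)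
  exact mul_le_mul_of_nonneg_right h2 (by positivity)

/-! ## Registered sub-goal (helper stub of `stub_apexDerivativeBounds`) -/

/-- **Registered helper stub `stub_apexSpatialBounds`** (sub-goal of `stub_apexDerivativeBounds`,
crux stmt-NavierStokesRegularity-11717): the apex-weighted bounds `‖DⁿV(t)(x)‖ ≤ L/(‖x‖+√(-t))^{n+1}`,
`n ≤ 3`, for Type-I ancient mild apex profiles, with `L` depending on `C` only.
[cite: SereginSverak2009, §2 p. 8] -/
theorem stub_apexSpatialBounds :
    ∀ C : ℝ, ∃ L : ℝ, 0 ≤ L ∧ ∀ (V : ℝ → EuclideanSpace ℝ (Fin 3) → EuclideanSpace ℝ (Fin 3)),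
      IsTypeIAncientMild C V → HasTypeIDecay C V → ∀ n ≤ 3, ∀ t < 0, ∀ x : EuclideanSpace ℝ (Fin 3),
        ‖iteratedFDeriv ℝ n (V t) x‖ ≤ L / (‖x‖ + Real.sqrt (-t)) ^ (n + 1) := by
  intro C
  obtain ⟨L, hL0, hL⟩ := exists_norm_iteratedFDeriv_le_apex C
  exact ⟨L, hL0, fun V hV hd => hL hV hd⟩

end Summit.NavierStokesRegularity.NavierStokesRegularity.Theorems.RellichScarScarRigidity

end
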